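import Literature.IUT.LogThetaLattice.HolomorphicLogShellVolume
import Literature.AnabelianGeometry.AbsoluteAnabelian.MonoAnalyticNonarchAlgorithmModel
import HarnessLib

/-!
# [IUTchIII] Prop 1.2 (iii)/(vi) — abc-iut-L6-t3's `LogLinkVolumeCompatible` (F-0429) and
# `HolMonoVolumeCompatible` (F-0428) as ZERO-HYPOTHESIS instance forms at the models of record
# (proof-only companion of `HolomorphicLogShells.lean`; abc-iut cell, layer L6, register row LF6-51)

S. Mochizuki, *Inter-universal Teichmüller theory III*, kurims manuscript (May 2020) `paper:url-4b091feeb646`,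
§1, Proposition 1.2 (iii) p. 31 ("the diagram (∗non) is compatible with the natural `p_v`-adic log-volumes")
and (vi) p. 32 ("the various isomorphisms `log(†D^⊢_v) ⥲ log(†F^{⊢×μ}_v) ⥲ log(†F_v)` … are compatible with …
the respective log-shells, and the respective log-volumes"); S. Mochizuki, *Topics in absolute anabelian
geometry III*, Prop 5.8 (i)–(iii) pp. 139–140 [cite: MochizukiAbsTopIII2015, Prop 5.8 (iii) p. 140].
Tag form [claim: Mochizuki2012, status: disputed] (D-0012 claim key) on every [IUTchIII] item.

abc-iut-L6-t3 typed the two clauses as predicates on the INPUTS (`HolomorphicLogShells.lean`, p404642):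
`HolMonoVolumeCompatible L t := μ^log_K(ℐ_L) = t.logShellLogVolume` and
`LogLinkVolumeCompatible L e := LogVolumeCompatible L.log ∧ ∀ A ∈ M(K), μ^log_{K'}(e(A)) = μ^log_K(A)`.
The tree's closers are CONDITIONAL instance forms — `holMonoVolumeCompatible_ofUnitLog (t) (hp) (hf) (he) (hm)`
(abc-iut-L6-d2, `HolomorphicLogShellVolume.lean`) pins the abstract numerical type `t` to `K` by four equations,
`logLinkVolumeCompatible_ofUnitLog (e) (he : Isometry e)` (`HolomorphicLogShellsProofs.lean`) asks the
identification `e` to be isometric — and abc-iut-L4's [AbsTopIII] Prop 5.8 model applies the first one only INSIDE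
the structure field `MonoAnalyticNonarch.ofPadicSubfield.logVol_logShell` / the proof of
`MonoAnalyticNonarchAlgorithm.model_realLogVol_logShell`, never as a theorem whose conclusion head IS the typed
predicate. This file records the instance forms WITH NO `Prop` HYPOTHESIS at the models of record:

* `holMonoVolumeCompatible_ofPadicSubfield` — **F-0428 at the genuine numerical type** `MLFType.ofPadicSubfield E =
  (p, f_E, e_E, m_E)` of a field `E ⊆ ℚ̄_p` finite over `ℚ_p` (the [AbsTopIII] Prop 5.8 model of record,
  `MonoAnalyticNonarchModel.lean`), for the genuine logarithm `log_p` (`PadicLogOnUnits.ofUnitLog p E`);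
* `holMonoVolumeCompatible_model_out_inv` — **F-0428 against the MONO-ANALYTICALLY RECONSTRUCTED type**: for every
  profinite `G` of MLF type and EVERY presentation `G ≅ G_E`, the holomorphic log-shell `ℐ_E` of `log_p` has
  log-volume the value `{-1 - m/f + e·log(p*)/log p}·f·log p` computed from the invariants `(p, f, e, m)` that
  abc-iut-L4's algorithm `MonoAnalyticNonarchAlgorithm.model` ([AbsTopIII] Prop 5.8 (i)) reconstructs from the
  group `G` ALONE — the printed comparison `log(†D^⊢_v)` (mono-analytic) vs `log(†F_v)` (holomorphic) of
  Prop 1.2 (vi), the single hypothesis being the datum's own `IsMLFGaloisType G`;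
* `logLinkVolumeCompatible_ofUnitLog_refl` — **F-0429 at the identity identification** of `log(†F_v)` with the
  codomain `Ψ^{gp}_{‡F_v}` read in ONE coric copy of `K` (vertical coricity, [IUTchIII] Prop 3.5 (i)), for every
  mixed-characteristic nonarchimedean local field `K` — zero hypotheses;
* `logLinkVolumeCompatible_ofUnitLog_of_norm_eq` — the isometric case from the usual spelling `‖e x‖ = ‖x‖`;
* `logLinkVolumeCompatible_ofPadicSubfield_refl` and the joint-inhabitation record
  `exists_holMono_and_logLink_ofPadicSubfield` — both schema rows F-0428 / F-0429 fire SIMULTANEOUSLY at one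
  genuine datum `(E ⊆ ℚ̄_p, log_p, (p, f_E, e_E, m_E), id)` (F-0429's universal closure is refuted in the tree,
  `not_forall_logLinkVolumeCompatible`; these are its instance forms, not the closure).

HONEST SCOPE: proof-only (0 `def`s, 0 instances, 0 `Prop` facts); every ingredient is consumed BY NAME
(abc-iut-L6-d2 `holMonoVolumeCompatible_ofUnitLog`, `logLinkVolumeCompatible_ofUnitLog`; abc-iut-L4
`MLFType.ofPadicSubfield`, `MonoAnalyticNonarchAlgorithm.model_out_inv_eq`). An instance-form theorem at OUR model is
not the print universal closure; nothing here bears on the disputed [IUTchIII] Cor. 3.12 or takes a side; typed ≠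
proved; instantiated ≠ endorsed.
-/

noncomputable section

namespace Literature.IUT.LogThetaLattice

open Literature.AnabelianGeometry.AbsoluteAnabelian
open scoped Literature.IUT.LogVolume

universe u

/-! ### F-0429 `LogLinkVolumeCompatible`: zero-hypothesis instance forms -/

section LogLink

variable (p : ℕ) [Fact p.Prime]
variable (K : Type*) [NontriviallyNormedField K] [NormedAlgebra ℚ_[p] K] [IsUltrametricDist K]
  [ProperSpace K] [MeasurableSpace K] [BorelSpace K]

/-- **IUTchIII:Prop1.2(iii)** (kurims p.31) — F-0429 INSTANCE FORM, ZERO hypotheses: at the genuine logarithm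
`log_p` of ANY mixed-characteristic nonarchimedean local field `K`, abc-iut-L6-t3's `LogLinkVolumeCompatible`
HOLDS for the identity identification of `log(†F_v)` with the codomain (all Frobenius-like copies read in one
coric `K`): `log_p` is log-volume compatible ([AbsTopIII] Prop 5.7 (i)(c)) and the identity preserves `μ^log`.
[claim: Mochizuki2012, status: disputed] -/
theorem logLinkVolumeCompatible_ofUnitLog_refl :
    LogLinkVolumeCompatible (PadicLogOnUnits.ofUnitLog p K) (RingEquiv.refl K) :=
  logLinkVolumeCompatible_ofUnitLog p K (RingEquiv.refl K) isometry_id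

/-- **IUTchIII:Prop1.2(iii)** (kurims p.31) — F-0429 for an identification `e : K ≃+* K'` that preserves the
norm (`‖e x‖ = ‖x‖`, the shape in which the poly-isomorphisms of `𝓕`-prime-strips deliver it), at the genuine
`log_p`: the norm equation is turned into `Isometry e` and abc-iut-L6-d2's `logLinkVolumeCompatible_ofUnitLog`
applies. [claim: Mochizuki2012, status: disputed] -/
theorem logLinkVolumeCompatible_ofUnitLog_of_norm_eq {K' : Type*} [NontriviallyNormedField K']
    [IsUltrametricDist K'] [ProperSpace K'] [MeasurableSpace K'] [BorelSpace K'] (e : K ≃+* K')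
    (he : ∀ x, ‖e x‖ = ‖x‖) :
    LogLinkVolumeCompatible (PadicLogOnUnits.ofUnitLog p K) e :=
  logLinkVolumeCompatible_ofUnitLog p K e (AddMonoidHomClass.isometry_of_norm e he)

end LogLink

/-! ### F-0428 `HolMonoVolumeCompatible` at the [AbsTopIII] Prop 5.8 model of record -/

section PadicSubfield

variable {p : ℕ} [Fact p.Prime] (E : IntermediateField ℚ_[p] (PadicAlgCl p)) [FiniteDimensional ℚ_[p] E]
  [MeasurableSpace E] [BorelSpace E]

/-- **IUTchIII:Prop1.2(vi)** (kurims p.32) — F-0428 INSTANCE FORM, ZERO hypotheses, at the model of record: for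
a field `E ⊆ ℚ̄_p` finite over `ℚ_p` with its GENUINE numerical type `MLFType.ofPadicSubfield E = (p, f_E, e_E, m_E)`
([AbsTopIII] Prop 5.8 (i); abc-iut-L4 `MonoAnalyticNonarchModel.lean`) and the genuine logarithm `log_p`,
abc-iut-L6-t3's `HolMonoVolumeCompatible` HOLDS: `μ^log_E(ℐ_E) = {-1 - m/f + e·log(p*)/log p}·f·log p`
(abc-iut-L6-d2 `holMonoVolumeCompatible_ofUnitLog`, its four pinning equations discharged by `rfl`).
[claim: Mochizuki2012, status: disputed] -/
theorem holMonoVolumeCompatible_ofPadicSubfield :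
    HolMonoVolumeCompatible (PadicLogOnUnits.ofUnitLog p E) (MLFType.ofPadicSubfield E) :=
  holMonoVolumeCompatible_ofUnitLog p E (MLFType.ofPadicSubfield E) rfl rfl rfl rfl

/-- **IUTchIII:Prop1.2(iii)** (kurims p.31) — F-0429 at the same model of record, identity identification,
zero hypotheses. [claim: Mochizuki2012, status: disputed] -/
theorem logLinkVolumeCompatible_ofPadicSubfield_refl :
    LogLinkVolumeCompatible (PadicLogOnUnits.ofUnitLog p E) (RingEquiv.refl E) :=
  logLinkVolumeCompatible_ofUnitLog_refl p E

/-- **IUTchIII:Prop1.2(iii)+(vi)** — JOINT INHABITATION of the two schema rows at ONE genuine datum: at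
`(E ⊆ ℚ̄_p, log_p)` there are a numerical type (the genuine one) and an identification (the identity) for which
F-0428 `HolMonoVolumeCompatible` and F-0429 `LogLinkVolumeCompatible` hold together — the instance forms are
not vacuous (F-0429's universal closure being refuted in the tree, `not_forall_logLinkVolumeCompatible`).
[claim: Mochizuki2012, status: disputed] -/
theorem exists_holMono_and_logLink_ofPadicSubfield :
    ∃ (t : MLFType) (e : E ≃+* E),
      HolMonoVolumeCompatible (PadicLogOnUnits.ofUnitLog p E) t ∧
        LogLinkVolumeCompatible (PadicLogOnUnits.ofUnitLog p E) e :=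
  ⟨MLFType.ofPadicSubfield E, RingEquiv.refl E, holMonoVolumeCompatible_ofPadicSubfield E,
    logLinkVolumeCompatible_ofPadicSubfield_refl E⟩

end PadicSubfield

/-! ### F-0428 against the mono-analytically reconstructed type ([AbsTopIII] Prop 5.8 ⟶ [IUTchIII] Prop 1.2 (vi)) -/

section Reconstructed

open MonoAnalyticNonarchAlgorithm

/-- **IUTchIII:Prop1.2(vi)** (kurims p.32) "`log(†D^⊢_v) ⥲ … ⥲ log(†F_v)` … compatible with … the respective
log-volumes" — F-0428 with the MONO-ANALYTIC side genuinely mono-analytic: for every profinite group `G` of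
MLF type and EVERY presentation `G ≅ G_E` (`E ⊆ ℚ̄_p` finite over `ℚ_p`), abc-iut-L6-t3's
`HolMonoVolumeCompatible` HOLDS for the genuine `log_p` of `E` and the numerical type `(p, f, e, m)` that
abc-iut-L4's algorithm `MonoAnalyticNonarchAlgorithm.model` ([AbsTopIII] Prop 5.8 (i)–(iii)) reconstructs from
`G` ALONE: the holomorphic log-volume of `ℐ_E` equals the group-theoretically reconstructed value
(`model_out_inv_eq` — the invariants are presentation-independent, [AbsAnab] Prop 1.2.1 — then
`holMonoVolumeCompatible_ofPadicSubfield`). The one hypothesis `hG` is the datum's own "`G` is of MLF type".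
[claim: Mochizuki2012, status: disputed] -/
theorem holMonoVolumeCompatible_model_out_inv (G : ProfiniteGrp.{0}) (hG : IsMLFGaloisType G)
    (P : Presentation G) :
    haveI := P.prime
    haveI := P.finite
    ∀ [MeasurableSpace P.E] [BorelSpace P.E],
      HolMonoVolumeCompatible (PadicLogOnUnits.ofUnitLog P.p P.E) (model.out G hG).inv := by
  haveI := P.prime
  haveI := P.finite
  intro _ _
  rw [model_out_inv_eq G hG P]
  exact holMonoVolumeCompatible_ofPadicSubfield P.E

/-- **IUTchIII:Prop1.2(vi)** (kurims p.32) — the same at the CHOSEN presentation of the algorithm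
(`MonoAnalyticNonarchAlgorithm.presentation G hG`), where the reconstructed type is literally
`MLFType.ofPadicSubfield _` (`model_out_inv`, `rfl`). [claim: Mochizuki2012, status: disputed] -/
theorem holMonoVolumeCompatible_model_out_inv_presentation (G : ProfiniteGrp.{0}) (hG : IsMLFGaloisType G) :
    haveI := (presentation G hG).prime
    haveI := (presentation G hG).finite
    ∀ [MeasurableSpace (presentation G hG).E] [BorelSpace (presentation G hG).E],
      HolMonoVolumeCompatible (PadicLogOnUnits.ofUnitLog (presentation G hG).p (presentation G hG).E)
        (model.out G hG).inv :=
  holMonoVolumeCompatible_model_out_inv G hG (presentation G hG)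

end Reconstructed

end Literature.IUT.LogThetaLattice

end
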